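import Literature.IUT.HodgeArakelov.ThetaEvaluationSettingR

/-!
# [IUTchII] Prop 2.2 (i): NON-VACUITY of the reference-pair interface `SubgraphReference`

Mochizuki, *Inter-universal Teichmüller theory II*, §2, Prop. 2.2 (i), kurims manuscript (Dec. 2020) p. 66
[claim: Mochizuki2012, status: disputed] (IUTchII §2 Prop 2.2 (i), kurims p.66): "the decomposition groups
determined, respectively, by the subgraphs `Γ•_X` and `Γ▶_X` — i.e., more precisely, the group `Π^tp_{X,ℍ}` of
[IUTchI], Corollary 2.3, (iii)". Record-only vocabulary under the claim key `Mochizuki2012` (D-0012, disputed);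
abc-iut cell, layer L6, NON-VACUITY CERTIFICATE (abc-iut-L6-lead §F v1.18p «NV-L6 WAVE», row
`NV-L6/SubgraphReference`; inhabitation census abc-iut-w5-d114 v3 §A: ZERO producers) for abc-iut-L6-d1's
interface `Literature.IUT.HodgeArakelov.SubgraphReference S` (`ThetaEvaluationSettingR.lean`, p408493), over which
the repaired Prop. 2.2 (i) statement `Prop22_i'`, its anabelian input `SubgraphReference.GroupTheoretic`, the
dischargers `prop22_i'_of_stableRepresentative` / `prop22_i'_of_groupTheoretic` (abc-iut-w4-d010) and the
[IUTchI] Cor. 2.3 bridge `prop22_i'_of_cor23iii_bridge` (abc-iut-w5-d086, p413787) are typed.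

What the kernel says (this file; proof-only: no `def`, no instance, no named fact; nothing asserted about print):

* `SubgraphReference.nonempty_degenerate` — the interface is inhabited over EVERY `S : BadPlaceSetting`, by the
  DEGENERATE pair `Π_{v▶} = Π_{v•} = 1` (both reference groups trivial). HONEST LABEL: degenerate; it certifies
  only that the interface carries NO hidden hypothesis on `S` (contrast `AbsTopMonoids.nonempty_iff`, whose
  interface forces «`Δ ⊆ Π` characteristic»), i.e. every theorem quantified over `R : SubgraphReference S` is
  instantiable at every setting.
* `SubgraphReference.nonempty_tower` — a NON-COLLAPSED witness over every `S`: `Π_{v▶} := Π^tp_{Y̲_v} = Π_v ∩ Π^tp_{Y_v}`,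
  `Π_{v•} := Π^tp_{Ÿ̲_v} = Π_v ∩ Π^tp_{Ÿ_v}` (the setting's own `Y`-tower, `refYdd_le`). HONEST LABEL: setting-level
  data but NOT the printed reference pair — `Π^tp_{Y̲_v}` is the maximal value the field `refTri_le_Y` allows, the
  printed `Π^tp_{X,Γ▶}` being a verticial decomposition group of infinite index in it.
* GENUINE witness (the printed pair `(Π^tp_{X,Γ▶_X}, Π^tp_{X,Γ•_X})` at the [EtTh] model
  `BadPlaceSetting.ofDoubleUnderline`, abc-iut-w4-d034): NV-BLOCKED — it needs the decomposition groups of the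
  irreducible components of the special fibre of `X̲̲_v` inside `Π^tp_{X̲̲}`, which neither the [EtTh] §1 interface
  `ThetaSetting` (only the combinatorial quotient `toZ : Π^tp_X ↠ Z`) nor the §2 setting carries; they are the
  objects of the MERGE-MAP row «SubgraphReference ↔ [IUTchI] Cor. 2.3 (iii) `StableCurveTemperedData.piTpXH`»
  (owners abc-iut-L6-t7 / abc-iut-L5-t1 / abc-iut-L2-t2), exactly the identification binders `j`, `e₀`, `hbullet`
  of `prop22_i'_of_cor23iii_bridge`. Nothing here bears on [IUTchIII] Cor. 3.12; no side is taken; a degenerate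
  witness is not a discharge.
-/

namespace Literature.IUT.HodgeArakelov

universe u

namespace SubgraphReference

/-- **IUTchII:Prop2.2(i)** reference-pair interface (kurims p. 66) — NON-VACUITY, DEGENERATE witness: over every
bad-place setting `S` the interface `SubgraphReference S` is inhabited by the trivial pair `Π_{v▶} = Π_{v•} = 1`
(so it hides no hypothesis on `S`). Degenerate: NOT the printed decomposition groups.
[claim: Mochizuki2012, status: disputed] (IUTchII §2 Prop 2.2 (i), kurims p.66) -/
theorem nonempty_degenerate (S : BadPlaceSetting.{u}) : Nonempty (SubgraphReference S) :=
  ⟨{ refTri := ⊥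
     refBullet := ⊥
     refBullet_le := le_rfl
     refTri_le_Y := bot_le }⟩

/-- **IUTchII:Prop2.2(i)** reference-pair interface (kurims p. 66) — NON-VACUITY, NON-COLLAPSED witness at the
setting's own `Y`-tower: `Π_{v▶} := Π^tp_{Y̲_v} = Π_v ∩ Π^tp_{Y_v}`, `Π_{v•} := Π^tp_{Ÿ̲_v} = Π_v ∩ Π^tp_{Ÿ_v}` (nested by
`refYdd_le`; `Π_{v▶} ≤ Π^tp_{Y̲_v}` with equality — the maximal value the interface allows). HONEST LABEL:
setting-level data, NOT the printed pair `(Π^tp_{X,Γ▶}, Π^tp_{X,Γ•})` (verticial decomposition groups, of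
infinite index in `Π^tp_{Y̲_v}`), whose construction is the MERGE-MAP row named in the module docstring.
[claim: Mochizuki2012, status: disputed] (IUTchII §2 Prop 2.2 (i), kurims p.66) -/
theorem nonempty_tower (S : BadPlaceSetting.{u}) :
    ∃ R : SubgraphReference S,
      R.refTri = S.refY.comap S.inclPlain ∧ R.refBullet = S.refYdd.comap S.inclPlain :=
  ⟨{ refTri := S.refY.comap S.inclPlain
     refBullet := S.refYdd.comap S.inclPlain
     refBullet_le := Subgroup.comap_mono S.refYdd_le
     refTri_le_Y := le_rfl }, rfl, rfl⟩

/-- The exact inhabitation condition of the interface: NONE — `SubgraphReference S` is inhabited for every `S`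
(so, unlike `AbsTopMonoids`, the content of Prop. 2.2 (i) sits entirely in the predicates OVER it:
`Prop22_i'`, `SubgraphReference.GroupTheoretic`, and the anti-vacuity `LiesOver.iota_ne_refl`).
[claim: Mochizuki2012, status: disputed] (IUTchII §2 Prop 2.2 (i), kurims p.66) -/
theorem nonempty_iff (S : BadPlaceSetting.{u}) : Nonempty (SubgraphReference S) ↔ True :=
  iff_true_intro (nonempty_degenerate S)

end SubgraphReference

end Literature.IUT.HodgeArakelov
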